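import Mathlib
import HarnessLib
import Summits.Ventures.LatticeQCDFlow.Exactness.SU2ExactForceWilson
import Summits.Ventures.LatticeQCDFlow.Exactness.SU2ExactForceCovariance
import Summits.Ventures.LatticeQCDFlow.Exactness.SU2WilsonForceCovariance

/-!
# `SU(2)` HMC driven by the EXACT autodiff gradient of `β·S_W` IS the HMC driven by the Wilson force routine `g_(2βcκ)` — the two Markov kernels coincide

HONEST FRAMING: exact (Metropolis-corrected) sampling algorithms for lattice gauge theory;
figures of merit are autocorrelation/cost numbers at stated couplings and volumes; no
continuum-physics claim.

Venture `LatticeQCDFlow` (cell pub-lqcd), topic `Exactness`; FANOUT row 14 (`eng-flowhmc`; identity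
member = plain `SU(2)` gauge-link HMC: refresh `N(0,1)` momenta, leapfrog^n with the quaternion
exponential drift and a force routine, flip, Metropolis on `β S_W + Σ p²/2`, forget).  NEW WORK of
the cell; nothing is cited as a fact; no number.  The kernel-level reading of
`SU2ExactForceWilson.su2ExactForceRoutine_eq_wilsonForceRoutine`:

* `su2_hmc_kernel_congr_force` — the HMC kernel depends on the force routine only through its
  values (the measurability certificate is proof-irrelevant);
* **`su2_hmc_exactForce_kernel_eq_wilsonForce_kernel`** — for `L ≥ 2` and every `β, c, κ, n`: the
  `SU(2)` HMC kernel whose leapfrog is driven by the EXACT gradient force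
  `κ · fderiv ℝ (p ↦ β S_W(exp(c p)·V)) 0` (measurability certificate
  `SU2ExactForceCovariance.measurable_su2ExactForce`) EQUALS the kernel driven by the closed-form
  Wilson routine with `κ' = 2βcκ` (certificate `SU2WilsonForceCovariance.measurable_su2WilsonForce`).
  Every theorem of the cell about the Wilson-routine kernel (gauge / translation covariance,
  exactness, `⟨e^(−ΔH)⟩ = 1`, …) is therefore a theorem about the autodiff kernel, verbatim.

NOT CLAIMED: non-identity members (the pulled-back action's gradient is not the Wilson routine);
`L = 1`; floating point; any number.
-/

noncomputable section

namespace Summit.Ventures.LatticeQCDFlow.Exactness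

open WithLp Set MeasureTheory
open ProbabilityTheory ProbabilityTheory.Kernel
open Literature.MathematicalPhysics.QuantumFieldTheory
open scoped ENNReal Matrix

variable {d L : ℕ} [NeZero L]

/-- The `SU(2)` HMC kernel with action `β·S_W` depends on the force routine only through its values. -/
theorem su2_hmc_kernel_congr_force (β c : ℝ) (n : ℕ) (g₁ g₂ : GaugeConfig d L (Matrix.specialUnitaryGroup (Fin 2) ℂ) → ((Edge d L × Fin 3) → ℝ))
    (h₁ : Measurable g₁) (h₂ : Measurable g₂)
    (hg : g₁ = g₂) :
      (refreshUpdate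
        (involMH
          (⇑((flip : Equiv.Perm (GaugeConfig d L (Matrix.specialUnitaryGroup (Fin 2) ℂ) × ((Edge d L × Fin 3) → ℝ))) *
              leapfrog (mulDrift fun p : ((Edge d L × Fin 3) → ℝ) =>
                fun ℓ : Edge d L => gaussUnit (toLp 2
          ![Real.cos (c * Real.sqrt (p (ℓ, 0) ^ 2 + p (ℓ, 1) ^ 2 + p (ℓ, 2) ^ 2)),
            c * Real.sinc (c * Real.sqrt (p (ℓ, 0) ^ 2 + p (ℓ, 1) ^ 2 + p (ℓ, 2) ^ 2)) * p (ℓ, 0),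
            c * Real.sinc (c * Real.sqrt (p (ℓ, 0) ^ 2 + p (ℓ, 1) ^ 2 + p (ℓ, 2) ^ 2)) * p (ℓ, 1),
            c * Real.sinc (c * Real.sqrt (p (ℓ, 0) ^ 2 + p (ℓ, 1) ^ 2 + p (ℓ, 2) ^ 2)) * p (ℓ, 2)])) g₁ ^ n))
          (measurable_flip_leapfrog_pow (measurable_mulDrift (measurable_su2Drift c)) h₁ n)
          fun z : GaugeConfig d L (Matrix.specialUnitaryGroup (Fin 2) ℂ) × ((Edge d L × Fin 3) → ℝ) => (fun W : GaugeConfig d L (Matrix.specialUnitaryGroup (Fin 2) ℂ) => β * wilsonAction (Matrix.specialUnitaryGroup (Fin 2) ℂ).subtype W) z.1 + ∑ i, z.2 i ^ 2 / 2)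
        ((((volume : Measure ((Edge d L × Fin 3) → ℝ)).withDensity
                  fun p => ENNReal.ofReal (Real.exp (-(∑ i, p i ^ 2 / 2)))) Set.univ)⁻¹ •
              (volume : Measure ((Edge d L × Fin 3) → ℝ)).withDensity
                fun p => ENNReal.ofReal (Real.exp (-(∑ i, p i ^ 2 / 2))))) =
      (refreshUpdate
        (involMH
          (⇑((flip : Equiv.Perm (GaugeConfig d L (Matrix.specialUnitaryGroup (Fin 2) ℂ) × ((Edge d L × Fin 3) → ℝ))) *
              leapfrog (mulDrift fun p : ((Edge d L × Fin 3) → ℝ) =>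
                fun ℓ : Edge d L => gaussUnit (toLp 2
          ![Real.cos (c * Real.sqrt (p (ℓ, 0) ^ 2 + p (ℓ, 1) ^ 2 + p (ℓ, 2) ^ 2)),
            c * Real.sinc (c * Real.sqrt (p (ℓ, 0) ^ 2 + p (ℓ, 1) ^ 2 + p (ℓ, 2) ^ 2)) * p (ℓ, 0),
            c * Real.sinc (c * Real.sqrt (p (ℓ, 0) ^ 2 + p (ℓ, 1) ^ 2 + p (ℓ, 2) ^ 2)) * p (ℓ, 1),
            c * Real.sinc (c * Real.sqrt (p (ℓ, 0) ^ 2 + p (ℓ, 1) ^ 2 + p (ℓ, 2) ^ 2)) * p (ℓ, 2)])) g₂ ^ n))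
          (measurable_flip_leapfrog_pow (measurable_mulDrift (measurable_su2Drift c)) h₂ n)
          fun z : GaugeConfig d L (Matrix.specialUnitaryGroup (Fin 2) ℂ) × ((Edge d L × Fin 3) → ℝ) => (fun W : GaugeConfig d L (Matrix.specialUnitaryGroup (Fin 2) ℂ) => β * wilsonAction (Matrix.specialUnitaryGroup (Fin 2) ℂ).subtype W) z.1 + ∑ i, z.2 i ^ 2 / 2)
        ((((volume : Measure ((Edge d L × Fin 3) → ℝ)).withDensity
                  fun p => ENNReal.ofReal (Real.exp (-(∑ i, p i ^ 2 / 2)))) Set.univ)⁻¹ •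
              (volume : Measure ((Edge d L × Fin 3) → ℝ)).withDensity
                fun p => ENNReal.ofReal (Real.exp (-(∑ i, p i ^ 2 / 2))))) := by
  subst hg
  rfl

/-- **The `SU(2)` HMC kernel driven by the exact autodiff gradient of `β·S_W` IS the kernel driven by
the Wilson force routine `g_(2βcκ)`** (`L ≥ 2`; any continuity certificate `hSc` of the action, e.g.
`continuous_const.mul (Elitzur.continuous_wilsonAction _ continuous_subtype_val)`). -/
theorem su2_hmc_exactForce_kernel_eq_wilsonForce_kernel (hL : 2 ≤ L) (β c κ : ℝ)
    (hSc : Continuous fun W : GaugeConfig d L (Matrix.specialUnitaryGroup (Fin 2) ℂ) => β * wilsonAction (Matrix.specialUnitaryGroup (Fin 2) ℂ).subtype W) (n : ℕ) :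
      (refreshUpdate
        (involMH
          (⇑((flip : Equiv.Perm (GaugeConfig d L (Matrix.specialUnitaryGroup (Fin 2) ℂ) × ((Edge d L × Fin 3) → ℝ))) *
              leapfrog (mulDrift fun p : ((Edge d L × Fin 3) → ℝ) =>
                fun ℓ : Edge d L => gaussUnit (toLp 2
          ![Real.cos (c * Real.sqrt (p (ℓ, 0) ^ 2 + p (ℓ, 1) ^ 2 + p (ℓ, 2) ^ 2)),
            c * Real.sinc (c * Real.sqrt (p (ℓ, 0) ^ 2 + p (ℓ, 1) ^ 2 + p (ℓ, 2) ^ 2)) * p (ℓ, 0),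
            c * Real.sinc (c * Real.sqrt (p (ℓ, 0) ^ 2 + p (ℓ, 1) ^ 2 + p (ℓ, 2) ^ 2)) * p (ℓ, 1),
            c * Real.sinc (c * Real.sqrt (p (ℓ, 0) ^ 2 + p (ℓ, 1) ^ 2 + p (ℓ, 2) ^ 2)) * p (ℓ, 2)])) (fun V : GaugeConfig d L (Matrix.specialUnitaryGroup (Fin 2) ℂ) => (fun q : Edge d L × Fin 3 => κ * fderiv ℝ (fun p : ((Edge d L × Fin 3) → ℝ) => (fun W : GaugeConfig d L (Matrix.specialUnitaryGroup (Fin 2) ℂ) => β * wilsonAction (Matrix.specialUnitaryGroup (Fin 2) ℂ).subtype W) ((fun ℓ : Edge d L => gaussUnit (toLp 2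
          ![Real.cos (c * Real.sqrt (p (ℓ, 0) ^ 2 + p (ℓ, 1) ^ 2 + p (ℓ, 2) ^ 2)),
            c * Real.sinc (c * Real.sqrt (p (ℓ, 0) ^ 2 + p (ℓ, 1) ^ 2 + p (ℓ, 2) ^ 2)) * p (ℓ, 0),
            c * Real.sinc (c * Real.sqrt (p (ℓ, 0) ^ 2 + p (ℓ, 1) ^ 2 + p (ℓ, 2) ^ 2)) * p (ℓ, 1),
            c * Real.sinc (c * Real.sqrt (p (ℓ, 0) ^ 2 + p (ℓ, 1) ^ 2 + p (ℓ, 2) ^ 2)) * p (ℓ, 2)])) * V)) 0 (Pi.single q 1))) ^ n))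
          (measurable_flip_leapfrog_pow (measurable_mulDrift (measurable_su2Drift c)) (measurable_su2ExactForce hSc c κ) n)
          fun z : GaugeConfig d L (Matrix.specialUnitaryGroup (Fin 2) ℂ) × ((Edge d L × Fin 3) → ℝ) => (fun W : GaugeConfig d L (Matrix.specialUnitaryGroup (Fin 2) ℂ) => β * wilsonAction (Matrix.specialUnitaryGroup (Fin 2) ℂ).subtype W) z.1 + ∑ i, z.2 i ^ 2 / 2)
        ((((volume : Measure ((Edge d L × Fin 3) → ℝ)).withDensity
                  fun p => ENNReal.ofReal (Real.exp (-(∑ i, p i ^ 2 / 2)))) Set.univ)⁻¹ •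
              (volume : Measure ((Edge d L × Fin 3) → ℝ)).withDensity
                fun p => ENNReal.ofReal (Real.exp (-(∑ i, p i ^ 2 / 2))))) =
      (refreshUpdate
        (involMH
          (⇑((flip : Equiv.Perm (GaugeConfig d L (Matrix.specialUnitaryGroup (Fin 2) ℂ) × ((Edge d L × Fin 3) → ℝ))) *
              leapfrog (mulDrift fun p : ((Edge d L × Fin 3) → ℝ) =>
                fun ℓ : Edge d L => gaussUnit (toLp 2
          ![Real.cos (c * Real.sqrt (p (ℓ, 0) ^ 2 + p (ℓ, 1) ^ 2 + p (ℓ, 2) ^ 2)),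
            c * Real.sinc (c * Real.sqrt (p (ℓ, 0) ^ 2 + p (ℓ, 1) ^ 2 + p (ℓ, 2) ^ 2)) * p (ℓ, 0),
            c * Real.sinc (c * Real.sqrt (p (ℓ, 0) ^ 2 + p (ℓ, 1) ^ 2 + p (ℓ, 2) ^ 2)) * p (ℓ, 1),
            c * Real.sinc (c * Real.sqrt (p (ℓ, 0) ^ 2 + p (ℓ, 1) ^ 2 + p (ℓ, 2) ^ 2)) * p (ℓ, 2)])) (fun V : GaugeConfig d L (Matrix.specialUnitaryGroup (Fin 2) ℂ) => (fun q : Edge d L × Fin 3 => (2 * β * c * κ) * vecQuat (((V q.1 : Matrix.specialUnitaryGroup (Fin 2) ℂ) : Matrix (Fin 2) (Fin 2) ℂ) * (quatVec (∑ ν ∈ Finset.univ.erase q.1.2,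
            (vecQuat (((V (Site.shift q.1.1 q.1.2, ν) * (V (Site.shift q.1.1 ν, q.1.2))⁻¹ * (V (q.1.1, ν))⁻¹)⁻¹ : (Matrix.specialUnitaryGroup (Fin 2) ℂ)) : Matrix (Fin 2) (Fin 2) ℂ) +
              vecQuat ((((V (Site.shift (q.1.1 - Pi.single ν 1) q.1.2, ν))⁻¹ * (V (q.1.1 - Pi.single ν 1, q.1.2))⁻¹ *
                V (q.1.1 - Pi.single ν 1, ν))⁻¹ : (Matrix.specialUnitaryGroup (Fin 2) ℂ)) : Matrix (Fin 2) (Fin 2) ℂ))))ᴴ) q.2.succ)) ^ n))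
          (measurable_flip_leapfrog_pow (measurable_mulDrift (measurable_su2Drift c)) (measurable_su2WilsonForce (d := d) (L := L) (2 * β * c * κ)) n)
          fun z : GaugeConfig d L (Matrix.specialUnitaryGroup (Fin 2) ℂ) × ((Edge d L × Fin 3) → ℝ) => (fun W : GaugeConfig d L (Matrix.specialUnitaryGroup (Fin 2) ℂ) => β * wilsonAction (Matrix.specialUnitaryGroup (Fin 2) ℂ).subtype W) z.1 + ∑ i, z.2 i ^ 2 / 2)
        ((((volume : Measure ((Edge d L × Fin 3) → ℝ)).withDensity
                  fun p => ENNReal.ofReal (Real.exp (-(∑ i, p i ^ 2 / 2)))) Set.univ)⁻¹ •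
              (volume : Measure ((Edge d L × Fin 3) → ℝ)).withDensity
                fun p => ENNReal.ofReal (Real.exp (-(∑ i, p i ^ 2 / 2))))) :=
  su2_hmc_kernel_congr_force β c n _ _ (measurable_su2ExactForce hSc c κ)
    (measurable_su2WilsonForce (d := d) (L := L) (2 * β * c * κ))
    (su2ExactForceRoutine_eq_wilsonForceRoutine hL β c κ)

end Summit.Ventures.LatticeQCDFlow.Exactness
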